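import Summits.QuantumFields.BalabanUV.Beta.AxialDressingRootedBm
import Summits.QuantumFields.BalabanUV.Beta.AxialCoordinateProjector

/-!
# PREPARATORY (pending β-lead RULING (R42-1); touches NO wall object): the block-mean-normalised projector VANISHES ON COMB BONDS and
# is REFLECTION-COVARIANT at the centred root; the matrix law `pmBm_refl`

HONEST FRAMING (cell charter, verbatim): «discharging BetaPertH makes Balaban's UV stability UNCONDITIONAL — a real
constructive-QFT result; it is NOT the continuum limit and NOT the Clay problem.»  DERIVED cell leaf (β sub-cell, lane an2 gen 12,
NOTE X-an2-42 §4(d) «what survives», facts 2 and 3 of 3); no statement of Bałaban's papers, no `[cite:]` tag, no `Prop` fact; instantiates no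
wall binder.  NOT `BetaPertH`; NOT continuum; NOT Clay.

## What is here
* §1 `blockMeanAt_step_of_blk_eq` ⇒ **`axProjBmAt_eq_zero_of_isCombBond`** (`(Π^ρ_bm A)_m(p) = 0` on comb bonds) ⇒ `pmBm_eq_zero_of_isCombBond`.
* §2 `blockMeanAt_R0`, `axProjBmAt_smul`, **`axProjBmAt_R1`** (`Π^{ctr}_bm (R1 α A) = R1 α (Π^{ctr}_bm A)`, `Odd N`: an5's `axProjAt_R1` + `treeGaugeAt_R1`
  + `blockSum_R0` + `grad_R0`), **`pmBm_refl`** (`pmBm b p a q = ε_a ε_b · pmBm b (bref α b p) a (bref α a q)` at the centred root, `Odd N`).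
With part `AxialDressingRootedBm` (window support) these are the three inputs under which parts 4–8, the coordinate projector and the wiring
re-issue verbatim over `pmBm`.  All declarations `[folklore]`; axioms standard.  Provenance: b2b-balaban β sub-cell, unit beta-an2 gen 12, 2026-08-19.
-/

open Finset
open scoped BigOperators
open Literature.MathematicalPhysics.QuantumFieldTheory
open Literature.MathematicalPhysics.QuantumFieldTheory.Balaban1983to89
open Literature.MathematicalPhysics.QuantumFieldTheory.Balaban1983to89.Beta
open AffineAveraging (Form0 Form1 box toSite unitVec unitVec_apply blockSum)
open AveragingContours (blk grad)
open AveragingContoursRooted (treeGaugeAt ctrOff ctr ctrOff_mem_box)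
open RootedComb (axProjAt axProjAt_apply axProjAt_R1 treeGaugeAt_R1 grad_R0 ctr_eq_toSite blk_sref)
open PolarizationSign (reflSign)
open ResolventReflection (sref bref bref_bref R0 R1 R1_add R1_smul R0_smul reflSign_mul_self blockSum_R0)
open Summit.QuantumFields.BalabanUV.Beta.AxialProjectorBlockMean (blockMeanAt bmGaugeAt axProjBmAt axProjBmAt_eq grad_sub)

namespace Summit.QuantumFields.BalabanUV.Beta.AxialDressingRooted

noncomputable section

variable {n : ℕ}

/-! ## §1 `Π_bm` vanishes on comb bonds -/

/-- [folklore] The block mean does not change across a bond inside one block. -/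
theorem blockMeanAt_step_of_blk_eq {N : ℕ} (f : Form0 n ℝ) {m : Fin n} {p : Fin n → ℤ} (h : blk N (p + unitVec m) = blk N p) :
    blockMeanAt N f (p + unitVec m) - blockMeanAt N f p = 0 := by
  unfold blockMeanAt
  rw [h, sub_self]

/-- [folklore] **`(Π^ρ_bm A)_m(p) = 0` ON COMB BONDS** (every one-form `A`). -/
theorem axProjBmAt_eq_zero_of_isCombBond {ρ : Fin n → ℤ} {N : ℕ} {m : Fin n} {p : Fin n → ℤ} (h : IsCombBondAt ρ N m p)
    (A : Form1 n ℝ) : axProjBmAt ρ N A m p = 0 := by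
  rw [axProjBmAt_eq, Pi.add_apply, Pi.add_apply, axProjAt_eq_zero_of_isCombBond h, zero_add]
  exact blockMeanAt_step_of_blk_eq _ h.2

/-- [folklore] In particular `pmBm ρ N β p α q = 0` for a comb bond `(β, p)`. -/
theorem pmBm_eq_zero_of_isCombBond {ρ : Fin n → ℤ} {N : ℕ} {β : Fin n} {p : Fin n → ℤ} (h : IsCombBondAt ρ N β p) (α : Fin n)
    (q : Fin n → ℤ) : pmBm ρ N β p α q = 0 :=
  axProjBmAt_eq_zero_of_isCombBond h _

/-! ## §2 Reflection covariance at the centred root -/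

/-- [folklore] The block mean commutes with the site reflection (`N ≥ 1`). -/
theorem blockMeanAt_R0 {N : ℕ} (hN : 1 ≤ N) (α : Fin n) (f : Form0 n ℝ) : blockMeanAt N (R0 α f) = R0 α (blockMeanAt N f) := by
  funext x
  unfold blockMeanAt
  rw [blockSum_R0]
  show blockSum N f (sref α (blk N x)) / (N : ℝ) ^ n = blockSum N f (blk N (sref α x)) / (N : ℝ) ^ n
  rw [blk_sref hN]

/-- [folklore] `Π_bm` is homogeneous (left multiplication by a constant, pointwise form). -/
theorem axProjBmAt_mulLeft (ρ : Fin n → ℤ) (N : ℕ) (c : ℝ) (A : Form1 n ℝ) (κ : Fin n) (x : Fin n → ℤ) :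
    axProjBmAt ρ N (fun κ z => c * A κ z) κ x = c * axProjBmAt ρ N A κ x := by
  have htg : ∀ y, treeGaugeAt ρ (fun κ z => c * A κ z) N y = c * treeGaugeAt ρ A N y := fun y => by
    have h := treeGaugeAt_map (AddMonoidHom.mulLeft c) ρ A N y
    simpa only [AddMonoidHom.coe_mulLeft] using h
  have htg' : treeGaugeAt ρ (fun κ z => c * A κ z) N = fun y => c * treeGaugeAt ρ A N y := funext htg
  have hbs : ∀ y, blockSum N (fun y => c * treeGaugeAt ρ A N y) y = c * blockSum N (treeGaugeAt ρ A N) y := fun y => by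
    simp only [blockSum, Finset.mul_sum]
  simp only [axProjBmAt, bmGaugeAt, blockMeanAt, grad, Pi.sub_apply, htg', hbs]
  ring

/-- [folklore] **THE CENTRED BLOCK-MEAN PROJECTOR IS REFLECTION-COVARIANT** (`N` odd, every axis): `Π^{ctr}_bm (R1 α A) = R1 α (Π^{ctr}_bm A)`. -/
theorem axProjBmAt_R1 {N : ℕ} (hN : Odd N) (α : Fin n) (A : Form1 n ℝ) :
    axProjBmAt (ctr n N) N (R1 α A) = R1 α (axProjBmAt (ctr n N) N A) := by
  rw [axProjBmAt_eq, axProjBmAt_eq, axProjAt_R1 hN, treeGaugeAt_R1 hN, blockMeanAt_R0 hN.pos, grad_R0, R1_add]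

/-- [folklore] The bond reflection transports real bond indicators (`R1_bondInd` of part 8, restated for `pmBm`'s use). -/
theorem pmBm_refl {N : ℕ} (hN : Odd N) (α b : Fin n) (p : Fin n → ℤ) (a : Fin n) (q : Fin n → ℤ) :
    pmBm (toSite (ctrOff n N)) N b p a q =
      reflSign α a * reflSign α b * pmBm (toSite (ctrOff n N)) N b (bref α b p) a (bref α a q) := by
  have key := congrFun (congrFun (axProjBmAt_R1 hN α (fun κ z => (bondInd a (bref α a q) κ z : ℝ))) b) p
  rw [← ctr_eq_toSite]
  unfold pmBm
  have eR : R1 α (axProjBmAt (ctr n N) N fun κ z => (bondInd a (bref α a q) κ z : ℝ)) b p =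
      reflSign α b * axProjBmAt (ctr n N) N (fun κ z => (bondInd a (bref α a q) κ z : ℝ)) b (bref α b p) := rfl
  have eL : axProjBmAt (ctr n N) N (R1 α fun κ z => (bondInd a (bref α a q) κ z : ℝ)) b p =
      reflSign α a * axProjBmAt (ctr n N) N (fun κ z => (bondInd a q κ z : ℝ)) b p := by
    rw [R1_bondInd]
    exact axProjBmAt_mulLeft (ctr n N) N (reflSign α a) (fun κ z => (bondInd a q κ z : ℝ)) b p
  rw [eL, eR] at key
  have hs := reflSign_mul_self α a
  calc axProjBmAt (ctr n N) N (fun κ z => (bondInd a q κ z : ℝ)) b p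
      = reflSign α a * reflSign α a * axProjBmAt (ctr n N) N (fun κ z => (bondInd a q κ z : ℝ)) b p := by rw [hs, one_mul]
    _ = reflSign α a * (reflSign α b * axProjBmAt (ctr n N) N (fun κ z => (bondInd a (bref α a q) κ z : ℝ)) b (bref α b p)) := by
        rw [mul_assoc, key]
    _ = _ := by ring

end

end Summit.QuantumFields.BalabanUV.Beta.AxialDressingRooted
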